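import Literature.ModelTheory.ExponentialFields.EOverRestrictedExp
import Literature.ModelTheory.ExponentialFields.ExistentialPreservation
import Mathlib.ModelTheory.Complexity
import HarnessLib

/-!
# den Besten's normal form (48): `L_e`-formulas are projections of `e`-polynomial equations

Topic `Literature/ModelTheory/ExponentialFields`.  In the proof that `T_e` is smooth
(M. den Besten, *Wilkie's Theorem and the Uniform Real Schanuel Conjecture*, MSc thesis, Utrecht
2016, Theorem 7.2.1, condition `S₂`), the model completeness of `T_e` and Lemma 2.1.5 give, for
every `L_e`-formula `φ(x̄)`, an integer polynomial `ρ ∈ ℤ[z₁, …, z_{2m+2n}]` with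

  `φ(x̄) ↔ ∃ y₁ … y_m ρ(ȳ, e(ȳ), x̄, e(x̄)) = 0`                                    (48)

— `e` applied to *variables* only.  This file proves (48) uniformly in the `e`-reducts of the
models `K` of `T_exp` (the models of `T_e` used in chapter 7), in the semantic-uniform style of
`ExistentialReduction.lean`:

* `RealExpModel.ePt v = (v, e ∘ v)` and `RealExpModel.IsEPolyDefinable S`: the family of
  conditions `S K ū` is, in every `K`, `∃ w̄, ρ((ū, w̄), e(ū, w̄)) = 0` for ONE polynomial `ρ` with integer
  coefficients (a term of the language of rings); closure under `∧` (sums of squares), `∨` (products), `∃`, substitution;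
* atoms: the graphs of the ring operations, of `e` (`y = e(x)` is the polynomial `Y - E_x`!), of
  the restricted exponential `exp↾[0,1]` (`IsEPolyDefinable.rexpGraph`: for `0 < v ≤ 1`,
  `exp v = e(w)` where `w² v + v = 1`), and `≤`, `<`, `≠` (squares and inverses);
* `IsEPolyDefinable.of_isExistential_orderedERing` / `_orderedRexpRing`: every existential
  `L_e`- (resp. `L_{exp↾}`-) formula is `e`-polynomially definable (den Besten, Lemma 2.1.5);
* **(48)**: `RealExpModel.exists_ePoly_iff_of_isModelComplete` (from `eTheory.IsModelComplete`)
  and `RealExpModel.exists_ePoly_iff_of_rexp_isModelComplete` (from Wilkie's First Main Theorem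
  for `exp↾[0,1]`, `rexpTheory.IsModelComplete`, through the `L_{exp↾}`-translation of
  `EOverRestrictedExp.lean` / `DefinitionalExpansion.lean`).

Nothing here is a named fact: the model completeness enters as an explicit hypothesis.

## References

* M. den Besten, MSc thesis, Utrecht 2016: (48) in the proof of Theorem 7.2.1; Lemma 2.1.5;
  Lemma 6.2.3. [DenBesten2016]
* A. J. Wilkie, J. Amer. Math. Soc. 9 (1996), §10 (smooth theories, S₂) and Theorem 11.1.
  [WilkieJAMS1996]
-/

noncomputable section

open FirstOrder FirstOrder.Language FirstOrder.Language.Structure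
open scoped FirstOrder

namespace Literature.ModelTheory.ExponentialFields

namespace RealExpModel

universe w

/-! ### `e`-polynomial conditions -/

/-- The point `(v̄, e(v̄))` at which `e`-polynomials in the variables `v̄` are evaluated.
[cite: DenBesten2016, Theorem 7.2.1 (48)] -/
def ePt {K : Language.Theory.ModelType.{0, 0, w} realExpTheory} {ι : Type*} (v : ι → K) :
    ι ⊕ ι → K :=
  Sum.elim v fun i => EFun.e (v i)

/-- Value of a plain variable. [folklore] -/
@[simp] theorem ePt_inl {K : Language.Theory.ModelType.{0, 0, w} realExpTheory} {ι : Type*}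
    (v : ι → K) (i : ι) : ePt v (Sum.inl i) = v i := rfl

/-- Value of an `e`-variable. [folklore] -/
@[simp] theorem ePt_inr {K : Language.Theory.ModelType.{0, 0, w} realExpTheory} {ι : Type*}
    (v : ι → K) (i : ι) : ePt v (Sum.inr i) = EFun.e (v i) := rfl

/-- Evaluation points are compatible with reindexing of the variables. [folklore] -/
theorem ePt_comp_map {K : Language.Theory.ModelType.{0, 0, w} realExpTheory} {ι κ : Type*}
    (v : κ → K) (g : ι → κ) : ePt v ∘ Sum.map g g = ePt (v ∘ g) := by
  funext z; rcases z with z | z <;> rfl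

/-- A family of conditions `S K ū` on `δ`-tuples of the models `K` of `T_exp` is
*`e`-polynomially definable* if ONE polynomial `ρ` with integer coefficients (presented as a
term of the language of rings, as in `Wilkie1996_expPolynomial_transfer`) gives, in every `K`,
`S K ū ↔ ∃ w̄, ρ((ū, w̄), e(ū, w̄)) = 0` (the normal form (48) of den Besten 2016, for conditions).
[cite: DenBesten2016, Theorem 7.2.1 (48)] -/
def IsEPolyDefinable {δ : Type}
    (S : ∀ K : Language.Theory.ModelType.{0, 0, w} realExpTheory, (δ → K) → Prop) : Prop :=
  ∃ (m : ℕ) (ρ : Language.orderedRing.Term ((δ ⊕ Fin m) ⊕ (δ ⊕ Fin m))),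
    ∀ (K : Language.Theory.ModelType.{0, 0, w} realExpTheory) (u : δ → K),
      S K u ↔ ∃ w' : Fin m → K, ρ.realize (ePt (Sum.elim u w')) = 0

namespace IsEPolyDefinable

variable {δ δ' : Type}
  {S S' : ∀ K : Language.Theory.ModelType.{0, 0, w} realExpTheory, (δ → K) → Prop}

/-- Invariance under equivalence of conditions. [folklore] -/
theorem congr (h : IsEPolyDefinable S) (hSS' : ∀ K u, S K u ↔ S' K u) : IsEPolyDefinable S' := by
  obtain ⟨m, ρ, hρ⟩ := h
  exact ⟨m, ρ, fun K u => (hSS' K u).symm.trans (hρ K u)⟩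

/-- A polynomial equation `ρ(ū, e(ū)) = 0` (no extra unknowns) is `e`-polynomially definable.
[folklore] -/
theorem of_poly (ρ : Language.orderedRing.Term (δ ⊕ δ)) :
    IsEPolyDefinable (fun (K : Language.Theory.ModelType.{0, 0, w} realExpTheory) (u : δ → K) =>
      ρ.realize (ePt u) = 0) := by
  refine ⟨0, ρ.relabel (Sum.map Sum.inl Sum.inl), fun K u => ?_⟩
  simp only [Term.realize_relabel, ePt_comp_map, Sum.elim_comp_inl]
  exact ⟨fun h => ⟨Fin.elim0, h⟩, fun ⟨_, h⟩ => h⟩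

/-- `False` (`1 = 0`). [folklore] -/
theorem of_false :
    IsEPolyDefinable (fun (K : Language.Theory.ModelType.{0, 0, w} realExpTheory) (_ : δ → K) =>
      False) :=
  (of_poly 1).congr fun K u => by simp

/-- `True` (`0 = 0`). [folklore] -/
theorem of_true :
    IsEPolyDefinable (fun (K : Language.Theory.ModelType.{0, 0, w} realExpTheory) (_ : δ → K) =>
      True) :=
  (of_poly 0).congr fun K u => by simp

/-- Substitution of variables. [folklore] -/
theorem comp (h : IsEPolyDefinable S) (g : δ → δ') :
    IsEPolyDefinable (fun (K : Language.Theory.ModelType.{0, 0, w} realExpTheory)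
      (u : δ' → K) => S K (u ∘ g)) := by
  obtain ⟨m, ρ, hρ⟩ := h
  refine ⟨m, ρ.relabel (Sum.map (Sum.map g _root_.id) (Sum.map g _root_.id)), fun K u => ?_⟩
  show S K (u ∘ g) ↔ _
  rw [hρ K (u ∘ g)]
  refine exists_congr fun w' => ?_
  rw [Term.realize_relabel, ePt_comp_map, Sum.elim_comp_map, Function.comp_id]

/-- Disjunction: the product of the two polynomials (blocks of extra unknowns side by side).
[cite: DenBesten2016, Lemma 2.1.5] -/
theorem or (h₁ : IsEPolyDefinable S) (h₂ : IsEPolyDefinable S') :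
    IsEPolyDefinable (fun K u => S K u ∨ S' K u) := by
  obtain ⟨m₁, ρ₁, hρ₁⟩ := h₁
  obtain ⟨m₂, ρ₂, hρ₂⟩ := h₂
  let ι₁ : δ ⊕ Fin m₁ → δ ⊕ Fin (m₁ + m₂) := Sum.map _root_.id (Fin.castAdd m₂)
  let ι₂ : δ ⊕ Fin m₂ → δ ⊕ Fin (m₁ + m₂) := Sum.map _root_.id (Fin.natAdd m₁)
  refine ⟨m₁ + m₂, ρ₁.relabel (Sum.map ι₁ ι₁) * ρ₂.relabel (Sum.map ι₂ ι₂), fun K u => ?_⟩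
  show S K u ∨ S' K u ↔ _
  rw [hρ₁ K u, hρ₂ K u]
  have e₁ : ∀ W : Fin (m₁ + m₂) → K, Sum.elim u W ∘ ι₁ = Sum.elim u (W ∘ Fin.castAdd m₂) := by
    intro W; funext z; rcases z with z | z <;> rfl
  have e₂ : ∀ W : Fin (m₁ + m₂) → K, Sum.elim u W ∘ ι₂ = Sum.elim u (W ∘ Fin.natAdd m₁) := by
    intro W; funext z; rcases z with z | z <;> rfl
  simp only [Language.orderedRing.realize_mul, Term.realize_relabel, ePt_comp_map, e₁, e₂, mul_eq_zero]
  constructor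
  · rintro (⟨w', hw⟩ | ⟨w', hw⟩)
    · refine ⟨Fin.append w' fun _ => 0, Or.inl ?_⟩
      have e : (Fin.append w' fun _ => (0 : K)) ∘ Fin.castAdd m₂ = w' := funext fun i => by simp
      rw [e]; exact hw
    · refine ⟨Fin.append (fun _ => 0) w', Or.inr ?_⟩
      have e : (Fin.append (fun _ => (0 : K)) w') ∘ Fin.natAdd m₁ = w' := funext fun i => by simp
      rw [e]; exact hw
  · rintro ⟨W, hW | hW⟩
    · exact Or.inl ⟨W ∘ Fin.castAdd m₂, hW⟩
    · exact Or.inr ⟨W ∘ Fin.natAdd m₁, hW⟩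

/-- Conjunction: the sum of the squares of the two polynomials. [cite: DenBesten2016, Lemma 2.1.5] -/
theorem and (h₁ : IsEPolyDefinable S) (h₂ : IsEPolyDefinable S') :
    IsEPolyDefinable (fun K u => S K u ∧ S' K u) := by
  obtain ⟨m₁, ρ₁, hρ₁⟩ := h₁
  obtain ⟨m₂, ρ₂, hρ₂⟩ := h₂
  let ι₁ : δ ⊕ Fin m₁ → δ ⊕ Fin (m₁ + m₂) := Sum.map _root_.id (Fin.castAdd m₂)
  let ι₂ : δ ⊕ Fin m₂ → δ ⊕ Fin (m₁ + m₂) := Sum.map _root_.id (Fin.natAdd m₁)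
  refine ⟨m₁ + m₂,
    ρ₁.relabel (Sum.map ι₁ ι₁) * ρ₁.relabel (Sum.map ι₁ ι₁) +
      ρ₂.relabel (Sum.map ι₂ ι₂) * ρ₂.relabel (Sum.map ι₂ ι₂), fun K u => ?_⟩
  show S K u ∧ S' K u ↔ _
  rw [hρ₁ K u, hρ₂ K u]
  have e₁ : ∀ W : Fin (m₁ + m₂) → K, Sum.elim u W ∘ ι₁ = Sum.elim u (W ∘ Fin.castAdd m₂) := by
    intro W; funext z; rcases z with z | z <;> rfl
  have e₂ : ∀ W : Fin (m₁ + m₂) → K, Sum.elim u W ∘ ι₂ = Sum.elim u (W ∘ Fin.natAdd m₁) := by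
    intro W; funext z; rcases z with z | z <;> rfl
  simp only [Language.orderedRing.realize_add, Language.orderedRing.realize_mul,
    Term.realize_relabel, ePt_comp_map, e₁, e₂, mul_self_add_mul_self_eq_zero]
  constructor
  · rintro ⟨⟨w₁, hw₁⟩, ⟨w₂, hw₂⟩⟩
    refine ⟨Fin.append w₁ w₂, ?_, ?_⟩
    · have e : (Fin.append w₁ w₂) ∘ Fin.castAdd m₂ = w₁ := funext fun i => by simp
      rw [e]; exact hw₁
    · have e : (Fin.append w₁ w₂) ∘ Fin.natAdd m₁ = w₂ := funext fun i => by simp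
      rw [e]; exact hw₂
  · rintro ⟨W, hW₁, hW₂⟩
    exact ⟨⟨W ∘ Fin.castAdd m₂, hW₁⟩, ⟨W ∘ Fin.natAdd m₁, hW₂⟩⟩

/-- Finitely many existential quantifiers (the quantified variables join the extra unknowns).
[cite: DenBesten2016, Lemma 2.1.5] -/
theorem exists_fin {l : ℕ}
    {S : ∀ K : Language.Theory.ModelType.{0, 0, w} realExpTheory, (δ ⊕ Fin l → K) → Prop}
    (h : IsEPolyDefinable S) :
    IsEPolyDefinable (fun (K : Language.Theory.ModelType.{0, 0, w} realExpTheory)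
      (u : δ → K) => ∃ w' : Fin l → K, S K (Sum.elim u w')) := by
  obtain ⟨m, ρ, hρ⟩ := h
  let r : (δ ⊕ Fin l) ⊕ Fin m → δ ⊕ Fin (l + m) :=
    Sum.elim (Sum.elim Sum.inl fun i => Sum.inr (Fin.castAdd m i)) fun j => Sum.inr (Fin.natAdd l j)
  have key : ∀ (K : Language.Theory.ModelType.{0, 0, w} realExpTheory) (u : δ → K)
      (W : Fin (l + m) → K),
      Sum.elim u W ∘ r = Sum.elim (Sum.elim u (W ∘ Fin.castAdd m)) (W ∘ Fin.natAdd l) := by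
    intro K u W
    funext c
    rcases c with (x | i) | j <;> rfl
  refine ⟨l + m, ρ.relabel (Sum.map r r), fun K u => ?_⟩
  simp only [Term.realize_relabel, ePt_comp_map, key]
  constructor
  · rintro ⟨w₀, hw₀⟩
    obtain ⟨w₁, hw₁⟩ := (hρ K (Sum.elim u w₀)).1 hw₀
    refine ⟨Fin.append w₀ w₁, ?_⟩
    have e₁ : (Fin.append w₀ w₁) ∘ Fin.castAdd m = w₀ := funext fun i => by simp
    have e₂ : (Fin.append w₀ w₁) ∘ Fin.natAdd l = w₁ := funext fun i => by simp
    rw [e₁, e₂]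
    exact hw₁
  · rintro ⟨W, hW⟩
    exact ⟨W ∘ Fin.castAdd m, (hρ K _).2 ⟨W ∘ Fin.natAdd l, hW⟩⟩

/-- Finite conjunctions. [cite: DenBesten2016, Lemma 2.1.5] -/
theorem forall_fin : ∀ {l : ℕ}
    {S : Fin l → ∀ K : Language.Theory.ModelType.{0, 0, w} realExpTheory, (δ → K) → Prop},
    (∀ i, IsEPolyDefinable (S i)) →
    IsEPolyDefinable (fun (K : Language.Theory.ModelType.{0, 0, w} realExpTheory)
      (u : δ → K) => ∀ i, S i K u)
  | 0, _, _ => of_true.congr fun K u => by simp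
  | _ + 1, S, h =>
    ((h 0).and (forall_fin fun i => h (Fin.succ i))).congr fun K u => by
      rw [Fin.forall_fin_succ]

/-- One existential quantifier over a `Unit`-indexed slot. [folklore] -/
theorem exists_unit
    {S : ∀ K : Language.Theory.ModelType.{0, 0, w} realExpTheory, (δ ⊕ Unit → K) → Prop}
    (h : IsEPolyDefinable S) :
    IsEPolyDefinable (fun (K : Language.Theory.ModelType.{0, 0, w} realExpTheory)
      (u : δ → K) => ∃ y : K, S K (Sum.elim u fun _ => y)) := by
  refine (exists_fin (l := 1) (h.comp (Sum.map _root_.id fun _ => (0 : Fin 1)))).congr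
    fun K u => ?_
  constructor
  · rintro ⟨w', hw⟩
    refine ⟨w' 0, ?_⟩
    have e : Sum.elim u w' ∘ Sum.map _root_.id (fun _ : Unit => (0 : Fin 1)) =
        Sum.elim u fun _ => w' 0 := by
      funext c; rcases c with x | ⟨⟩ <;> rfl
    rw [e] at hw
    exact hw
  · rintro ⟨y, hy⟩
    refine ⟨fun _ => y, ?_⟩
    have e : Sum.elim u (fun _ : Fin 1 => y) ∘ Sum.map _root_.id (fun _ : Unit => (0 : Fin 1)) =
        Sum.elim u fun _ => y := by
      funext c; rcases c with x | ⟨⟩ <;> rfl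
    rw [e]
    exact hy

/-! ### Atoms on variables -/

/-- `u a = u b`. [folklore] -/
theorem eq_var (a b : δ) :
    IsEPolyDefinable (fun (K : Language.Theory.ModelType.{0, 0, w} realExpTheory) (u : δ → K) =>
      u a = u b) :=
  (of_poly (var (Sum.inl a) + -var (Sum.inl b))).congr fun K u => by
    simp [← sub_eq_add_neg, sub_eq_zero]

/-- `u a ≠ u b` (`∃ w, (u a - u b) w - 1 = 0`). [folklore] -/
theorem ne_var (a b : δ) :
    IsEPolyDefinable (fun (K : Language.Theory.ModelType.{0, 0, w} realExpTheory) (u : δ → K) =>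
      u a ≠ u b) := by
  refine (exists_fin (l := 1) (of_poly
    ((var (Sum.inl (Sum.inl a)) + -var (Sum.inl (Sum.inl b))) * var (Sum.inl (Sum.inr 0)) + -1))).congr
    fun K u => ?_
  simp only [Language.orderedRing.realize_add, Language.orderedRing.realize_mul,
    Language.orderedRing.realize_neg, Language.orderedRing.realize_one, Term.realize_var, ePt_inl,
    Sum.elim_inl, Sum.elim_inr, ← sub_eq_add_neg, sub_eq_zero]
  constructor
  · rintro ⟨c, hc⟩ heq
    rw [heq, sub_self, zero_mul] at hc
    exact zero_ne_one hc
  · intro hne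
    exact ⟨fun _ => (u a - u b)⁻¹, mul_inv_cancel₀ (sub_ne_zero.2 hne)⟩

/-- `u a ≤ u b` (`∃ w, u b - u a - w² = 0`). [folklore] -/
theorem le_var (a b : δ) :
    IsEPolyDefinable (fun (K : Language.Theory.ModelType.{0, 0, w} realExpTheory) (u : δ → K) =>
      u a ≤ u b) := by
  refine (exists_fin (l := 1) (of_poly
    (var (Sum.inl (Sum.inl b)) + -var (Sum.inl (Sum.inl a)) +
      -(var (Sum.inl (Sum.inr 0)) * var (Sum.inl (Sum.inr 0)))))).congr fun K u => ?_
  simp only [Language.orderedRing.realize_add, Language.orderedRing.realize_mul,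
    Language.orderedRing.realize_neg, Term.realize_var, ePt_inl, Sum.elim_inl, Sum.elim_inr,
    ← sub_eq_add_neg, sub_eq_zero, le_iff_exists_mul_self]
  exact ⟨fun ⟨w', h⟩ => ⟨w' 0, h⟩, fun ⟨c, hc⟩ => ⟨fun _ => c, hc⟩⟩

/-- `¬ u a ≤ u b` (`∃ w, (u a - u b) w² - 1 = 0`). [folklore] -/
theorem not_le_var (a b : δ) :
    IsEPolyDefinable (fun (K : Language.Theory.ModelType.{0, 0, w} realExpTheory) (u : δ → K) =>
      ¬ u a ≤ u b) := by
  refine (exists_fin (l := 1) (of_poly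
    ((var (Sum.inl (Sum.inl a)) + -var (Sum.inl (Sum.inl b))) *
        (var (Sum.inl (Sum.inr 0)) * var (Sum.inl (Sum.inr 0))) + -1))).congr fun K u => ?_
  rw [_root_.not_le, lt_iff_exists_mul_self]
  simp only [Language.orderedRing.realize_add, Language.orderedRing.realize_mul,
    Language.orderedRing.realize_neg, Language.orderedRing.realize_one, Term.realize_var, ePt_inl,
    Sum.elim_inl, Sum.elim_inr, ← sub_eq_add_neg, sub_eq_zero]
  constructor
  · rintro ⟨w', h⟩; exact ⟨w' 0, h⟩
  · rintro ⟨c, hc⟩; exact ⟨fun _ => c, hc⟩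

/-- **The graph of `e` on variables is a polynomial condition**: `u b = e (u a)` is
`Y_b - E_a = 0`. [cite: DenBesten2016, Theorem 7.2.1 (48)] -/
theorem e_var (a b : δ) :
    IsEPolyDefinable (fun (K : Language.Theory.ModelType.{0, 0, w} realExpTheory) (u : δ → K) =>
      u b = EFun.e (u a)) :=
  (of_poly (var (Sum.inl b) + -var (Sum.inr a))).congr fun K u => by
    simp [← sub_eq_add_neg, sub_eq_zero]

/-- The graphs of the ordered-ring operations on variables are polynomial conditions.
[folklore] -/
theorem ringFun_var {l : ℕ} (f : Language.orderedRing.Functions l) (args : Fin l → δ) (b : δ) :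
    IsEPolyDefinable (fun (K : Language.Theory.ModelType.{0, 0, w} realExpTheory) (u : δ → K) =>
      u b = funMap (L := Language.orderedRing) f (u ∘ args)) := by
  cases f
  · refine (of_poly (var (Sum.inl b) + -(var (Sum.inl (args 0)) + var (Sum.inl (args 1))))).congr
      fun K u => ?_
    simp only [Language.orderedRing.realize_add, Language.orderedRing.realize_neg, Term.realize_var,
      ePt_inl, add_neg_eq_zero, Language.orderedRing.funMap_add, Function.comp_apply]
  · refine (of_poly (var (Sum.inl b) + -(var (Sum.inl (args 0)) * var (Sum.inl (args 1))))).congr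
      fun K u => ?_
    simp only [Language.orderedRing.realize_add, Language.orderedRing.realize_neg,
      Language.orderedRing.realize_mul, Term.realize_var, ePt_inl, add_neg_eq_zero,
      Language.orderedRing.funMap_mul, Function.comp_apply]
  · refine (of_poly (var (Sum.inl b) + var (Sum.inl (args 0)))).congr fun K u => ?_
    simp only [Language.orderedRing.realize_add, Term.realize_var, ePt_inl, add_eq_zero_iff_eq_neg,
      Language.orderedRing.funMap_neg, Function.comp_apply]
  · refine (of_poly (var (Sum.inl b))).congr fun K u => ?_
    simp only [Term.realize_var, ePt_inl, Language.orderedRing.funMap_zero]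
  · refine (of_poly (var (Sum.inl b) + -1)).congr fun K u => ?_
    simp only [Language.orderedRing.realize_add, Language.orderedRing.realize_neg,
      Language.orderedRing.realize_one, Term.realize_var, ePt_inl, add_neg_eq_zero,
      Language.orderedRing.funMap_one]

/-- A square root of `(1 - v)/v` for `0 < v ≤ 1`, and the resulting identity `e(w) = exp v`.
[folklore] -/
theorem exists_sq_mul_add_eq_one {K : Language.Theory.ModelType.{0, 0, w} realExpTheory} {v : K}
    (h0 : 0 < v) (h1 : v ≤ 1) : ∃ w' : K, w' * w' * v + v = 1 ∧ EFun.e w' = exp v := by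
  obtain ⟨w', hw'⟩ := exists_mul_self_eq (show (0 : K) ≤ (1 - v) / v from
    div_nonneg (sub_nonneg.2 h1) h0.le)
  have hmul : w' * w' * v + v = 1 := by
    rw [hw', div_mul_cancel₀ _ h0.ne']; ring
  refine ⟨w', hmul, ?_⟩
  rw [e_def]
  congr 1
  have : (1 : K) + w' ^ 2 = v⁻¹ := by
    apply eq_inv_of_mul_eq_one_left
    calc (1 + w' ^ 2) * v = w' * w' * v + v := by ring
      _ = 1 := hmul
  rw [this, inv_inv]

/-- **The graph of `exp↾[0,1]` on variables is `e`-polynomially definable**: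
`y = exp↾(v) ↔ (v = 0 ∧ y = 1) ∨ (0 < v ≤ 1 ∧ ∃ w (w² v + v = 1 ∧ y = e(w))) ∨ ((v < 0 ∨ 1 < v) ∧ y = 0)`
(den Besten 2016, Lemma 6.2.3: `exp↾` is existentially definable from `e`). [cite: DenBesten2016, Lemma 6.2.3] -/
theorem rexp_var (a b : δ) :
    IsEPolyDefinable (fun (K : Language.Theory.ModelType.{0, 0, w} realExpTheory) (u : δ → K) =>
      u b = RexpFun.rexp (u a)) := by
  -- the middle branch's inner existential `∃ w, w² u_a + u_a = 1 ∧ u_b = e(w)`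
  have hmid : IsEPolyDefinable (fun (K : Language.Theory.ModelType.{0, 0, w} realExpTheory)
      (u : δ → K) => ∃ w' : Fin 1 → K, (w' 0 * w' 0 * u a + u a = 1) ∧ u b = EFun.e (w' 0)) := by
    have h1 : IsEPolyDefinable (fun (K : Language.Theory.ModelType.{0, 0, w} realExpTheory)
        (v : δ ⊕ Fin 1 → K) =>
          v (Sum.inr 0) * v (Sum.inr 0) * v (Sum.inl a) + v (Sum.inl a) = 1) :=
      (of_poly (var (Sum.inl (Sum.inr 0)) * var (Sum.inl (Sum.inr 0)) * var (Sum.inl (Sum.inl a)) +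
        var (Sum.inl (Sum.inl a)) + -1)).congr fun K v => by
          simp [← sub_eq_add_neg, sub_eq_zero]
    have h2 : IsEPolyDefinable (fun (K : Language.Theory.ModelType.{0, 0, w} realExpTheory)
        (v : δ ⊕ Fin 1 → K) => v (Sum.inl b) = EFun.e (v (Sum.inr 0))) :=
      e_var (Sum.inr 0) (Sum.inl b)
    exact (exists_fin (h1.and h2)).congr fun K u => Iff.rfl
  -- the constants `0, 1` as pinned extra unknowns
  have hc : IsEPolyDefinable (fun (K : Language.Theory.ModelType.{0, 0, w} realExpTheory)
      (v : δ ⊕ Fin 2 → K) => v (Sum.inr 0) = 0 ∧ v (Sum.inr 1) = 1) :=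
    ((of_poly (var (Sum.inl (Sum.inr 0)))).congr fun K v => by simp).and
      ((of_poly (var (Sum.inl (Sum.inr 1)) + -1)).congr fun K v => by
        simp [← sub_eq_add_neg, sub_eq_zero])
  have hcs : IsEPolyDefinable (fun (K : Language.Theory.ModelType.{0, 0, w} realExpTheory)
      (v : δ ⊕ Fin 2 → K) =>
        (v (Sum.inl a) = v (Sum.inr 0) ∧ v (Sum.inl b) = v (Sum.inr 1)) ∨
        ((¬ v (Sum.inl a) ≤ v (Sum.inr 0) ∧ v (Sum.inl a) ≤ v (Sum.inr 1)) ∧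
          ∃ w' : Fin 1 → K, (w' 0 * w' 0 * v (Sum.inl a) + v (Sum.inl a) = 1) ∧
            v (Sum.inl b) = EFun.e (w' 0)) ∨
        ((¬ v (Sum.inr 0) ≤ v (Sum.inl a) ∨ ¬ v (Sum.inl a) ≤ v (Sum.inr 1)) ∧
          v (Sum.inl b) = v (Sum.inr 0))) :=
    ((eq_var _ _).and (eq_var _ _)).or
      ((((not_le_var _ _).and (le_var _ _)).and
        ((hmid.comp (Sum.inl : δ → δ ⊕ Fin 2)).congr fun K v => Iff.rfl)).or
        (((not_le_var _ _).or (not_le_var _ _)).and (eq_var _ _)))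
  refine (exists_fin (hc.and hcs)).congr fun K u => ?_
  simp only [Sum.elim_inl, Sum.elim_inr]
  constructor
  · rintro ⟨c, ⟨hc0, hc1⟩, hcase⟩
    rw [hc0, hc1] at hcase
    rw [rexp_def]
    rcases hcase with ⟨ha0, hb1⟩ | ⟨⟨ha0, ha1⟩, w', hw', hbw⟩ | ⟨hout, hb0⟩
    · rw [if_pos ⟨le_of_eq ha0.symm, by rw [ha0]; exact zero_le_one⟩, hb1, ha0, exp_zero]
    · rw [_root_.not_le] at ha0
      rw [if_pos ⟨ha0.le, ha1⟩, hbw, e_def]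
      congr 1
      have : (1 : K) + w' 0 ^ 2 = (u a)⁻¹ := by
        apply eq_inv_of_mul_eq_one_left
        calc (1 + w' 0 ^ 2) * u a = w' 0 * w' 0 * u a + u a := by ring
          _ = 1 := hw'
      rw [this, inv_inv]
    · rw [_root_.not_le, _root_.not_le] at hout
      rw [if_neg (fun hh => hout.elim (fun h1 => not_lt.2 hh.1 h1) fun h2 => not_lt.2 hh.2 h2),
        hb0]
  · intro hb
    refine ⟨![0, 1], ⟨rfl, rfl⟩, ?_⟩
    simp only [Matrix.cons_val_zero, Matrix.cons_val_one]
    rw [rexp_def] at hb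
    by_cases hcase : 0 ≤ u a ∧ u a ≤ 1
    · rw [if_pos hcase] at hb
      rcases hcase.1.lt_or_eq with hlt | heq
      · refine Or.inr (Or.inl ⟨⟨not_le.2 hlt, hcase.2⟩, ?_⟩)
        obtain ⟨w', hw', hew'⟩ := exists_sq_mul_add_eq_one hlt hcase.2
        exact ⟨fun _ => w', hw', by rw [hb, hew']⟩
      · exact Or.inl ⟨heq.symm, by rw [hb, ← heq, exp_zero]⟩
    · rw [if_neg hcase] at hb
      refine Or.inr (Or.inr ⟨?_, hb⟩)
      rcases not_and_or.1 hcase with h1 | h2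
      · exact Or.inl h1
      · exact Or.inr h2

/-! ### Unnesting terms and formulas of an expansion with `e`-polynomially definable symbols -/

section Generic

universe u' v'

variable {L' : FirstOrder.Language.{u', v'}}
  [∀ K : Language.Theory.ModelType.{0, 0, w} realExpTheory, L'.Structure K]

/-- **Graphs of `L'`-terms are `e`-polynomially definable** when those of the function symbols
are (unnesting, den Besten 2016, Lemma 2.1.5, Claim). [cite: DenBesten2016, Lemma 2.1.5] -/
theorem termGraph_of_graphs
    (hfun : ∀ {l : ℕ} (g : L'.Functions l),
      IsEPolyDefinable (fun (K : Language.Theory.ModelType.{0, 0, w} realExpTheory)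
        (u : Fin l ⊕ Unit → K) => u (Sum.inr ()) = funMap g (u ∘ Sum.inl)))
    {δ : Type} (s : L'.Term δ) :
    IsEPolyDefinable (fun (K : Language.Theory.ModelType.{0, 0, w} realExpTheory)
      (u : δ ⊕ Unit → K) => u (Sum.inr ()) = s.realize (u ∘ Sum.inl)) := by
  induction s with
  | var x => exact (eq_var (Sum.inr ()) (Sum.inl x)).congr fun K u => by simp
  | func g ts ih =>
    rename_i l
    have hargs : IsEPolyDefinable (fun (K : Language.Theory.ModelType.{0, 0, w} realExpTheory)
        (u : (δ ⊕ Unit) ⊕ Fin l → K) =>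
          ∀ i, u (Sum.inr i) = (ts i).realize (u ∘ Sum.inl ∘ Sum.inl)) :=
      forall_fin fun i => ((ih i).comp (Definitions.argIdx δ l i)).congr fun K u => Iff.rfl
    have hval : IsEPolyDefinable (fun (K : Language.Theory.ModelType.{0, 0, w} realExpTheory)
        (u : (δ ⊕ Unit) ⊕ Fin l → K) =>
          u (Sum.inl (Sum.inr ())) = funMap g (u ∘ Sum.inr)) :=
      ((hfun g).comp (Sum.elim (fun i => Sum.inr i) fun _ => Sum.inl (Sum.inr ()) :
          Fin l ⊕ Unit → (δ ⊕ Unit) ⊕ Fin l)).congr fun K u => Iff.rfl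
    refine (exists_fin (hargs.and hval)).congr fun K u => ?_
    simp only [Sum.elim_inr, Sum.elim_inl, Term.realize_func]
    constructor
    · rintro ⟨w', hw', h⟩
      have : w' = fun i => (ts i).realize (u ∘ Sum.inl) := funext fun i => by
        rw [hw' i]; rfl
      rw [h, this]
      rfl
    · intro h
      refine ⟨fun i => (ts i).realize (u ∘ Sum.inl), fun i => rfl, ?_⟩
      rw [h]
      rfl

variable (hfun : ∀ {l : ℕ} (g : L'.Functions l),
    IsEPolyDefinable (fun (K : Language.Theory.ModelType.{0, 0, w} realExpTheory)
      (u : Fin l ⊕ Unit → K) => u (Sum.inr ()) = funMap g (u ∘ Sum.inl)))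
include hfun

/-- A condition on the values of `L'`-terms that is `e`-polynomially definable as a condition on
variables is `e`-polynomially definable. [cite: DenBesten2016, Lemma 2.1.5] -/
theorem rel_of_graphs {δ : Type} {l : ℕ}
    {P : ∀ K : Language.Theory.ModelType.{0, 0, w} realExpTheory, (Fin l → K) → Prop}
    (hP : IsEPolyDefinable P) (ts : Fin l → L'.Term δ) :
    IsEPolyDefinable (fun (K : Language.Theory.ModelType.{0, 0, w} realExpTheory) (u : δ → K) =>
      P K fun i => (ts i).realize u) := by
  have hargs : IsEPolyDefinable (fun (K : Language.Theory.ModelType.{0, 0, w} realExpTheory)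
      (u : δ ⊕ Fin l → K) => ∀ i, u (Sum.inr i) = (ts i).realize (u ∘ Sum.inl)) :=
    forall_fin fun i =>
      ((termGraph_of_graphs hfun (ts i)).comp (Definitions.argIdx' δ l i)).congr
        fun K u => Iff.rfl
  have hval : IsEPolyDefinable (fun (K : Language.Theory.ModelType.{0, 0, w} realExpTheory)
      (u : δ ⊕ Fin l → K) => P K (u ∘ Sum.inr)) :=
    hP.comp Sum.inr
  refine (exists_fin (hargs.and hval)).congr fun K u => ?_
  simp only [Sum.elim_inr, Sum.elim_comp_inl, Sum.elim_comp_inr]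
  constructor
  · rintro ⟨w', hw', h⟩
    have : w' = fun i => (ts i).realize u := funext fun i => hw' i
    rw [this] at h
    exact h
  · intro h
    exact ⟨fun i => (ts i).realize u, fun i => rfl, h⟩

variable (hrel : ∀ {l : ℕ} (R : L'.Relations l),
    IsEPolyDefinable (fun (K : Language.Theory.ModelType.{0, 0, w} realExpTheory)
        (u : Fin l → K) => RelMap R u) ∧
      IsEPolyDefinable (fun (K : Language.Theory.ModelType.{0, 0, w} realExpTheory)
        (u : Fin l → K) => ¬ RelMap R u))
include hrel

/-- **Quantifier-free `L'`-conditions are `e`-polynomially definable** (with their negations).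
[cite: DenBesten2016, Lemma 2.1.5] -/
theorem of_isQF_of_graphs {γ : Type} {n : ℕ} {χ : L'.BoundedFormula γ n} (hχ : χ.IsQF) :
    IsEPolyDefinable (fun (K : Language.Theory.ModelType.{0, 0, w} realExpTheory)
        (u : γ ⊕ Fin n → K) => χ.Realize (u ∘ Sum.inl) (u ∘ Sum.inr)) ∧
      IsEPolyDefinable (fun (K : Language.Theory.ModelType.{0, 0, w} realExpTheory)
        (u : γ ⊕ Fin n → K) => ¬ χ.Realize (u ∘ Sum.inl) (u ∘ Sum.inr)) := by
  induction hχ with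
  | falsum =>
    exact ⟨of_false.congr fun K u => by simp [BoundedFormula.Realize],
      of_true.congr fun K u => by simp [BoundedFormula.Realize]⟩
  | of_isAtomic h =>
    cases h with
    | equal t₁ t₂ =>
      refine ⟨(rel_of_graphs hfun (eq_var (0 : Fin 2) 1) ![t₁, t₂]).congr fun K u => ?_,
        (rel_of_graphs hfun (ne_var (0 : Fin 2) 1) ![t₁, t₂]).congr fun K u => ?_⟩
      · simp
      · simp
    | rel R ts =>
      refine ⟨(rel_of_graphs hfun (hrel R).1 ts).congr fun K u => ?_,
        (rel_of_graphs hfun (hrel R).2 ts).congr fun K u => ?_⟩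
      · simp only [BoundedFormula.realize_rel, Sum.elim_comp_inl_inr]
      · simp only [BoundedFormula.realize_rel, Sum.elim_comp_inl_inr]
  | imp _ _ ih₁ ih₂ =>
    obtain ⟨p₁, n₁⟩ := ih₁
    obtain ⟨p₂, n₂⟩ := ih₂
    refine ⟨(n₁.or p₂).congr fun K u => ?_, (p₁.and n₂).congr fun K u => ?_⟩
    · simp only [BoundedFormula.realize_imp]; tauto
    · simp only [BoundedFormula.realize_imp]; tauto

/-- **Existential `L'`-conditions are `e`-polynomially definable**: uniformly in the models of
`T_exp`, `K ⊨ φ(ū) ↔ ∃ w̄, ρ((ū, w̄), e(ū, w̄)) = 0` for one integer polynomial `ρ`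
(den Besten 2016, Lemma 2.1.5 and (48)). [cite: DenBesten2016, Lemma 2.1.5] -/
theorem of_isExistential_of_graphs {γ : Type} {n : ℕ} {φ : L'.BoundedFormula γ n}
    (hφ : φ.IsExistential) :
    IsEPolyDefinable (fun (K : Language.Theory.ModelType.{0, 0, w} realExpTheory)
        (u : γ ⊕ Fin n → K) => φ.Realize (u ∘ Sum.inl) (u ∘ Sum.inr)) := by
  induction hφ with
  | of_isQF h => exact (of_isQF_of_graphs hfun hrel h).1
  | @ex n θ _ ih =>
    have h' : IsEPolyDefinable (fun (K : Language.Theory.ModelType.{0, 0, w} realExpTheory)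
        (u : (γ ⊕ Fin n) ⊕ Unit → K) =>
          θ.Realize (u ∘ Sum.inl ∘ Sum.inl) (Fin.snoc (u ∘ Sum.inl ∘ Sum.inr) (u (Sum.inr ())))) := by
      refine (ih.comp (Definitions.snocIdx γ n)).congr fun K u => ?_
      have e₁ : (u ∘ Definitions.snocIdx γ n) ∘ Sum.inl = u ∘ Sum.inl ∘ Sum.inl := by
        funext x; rfl
      have e₂ : (u ∘ Definitions.snocIdx γ n) ∘ Sum.inr =
          Fin.snoc (u ∘ Sum.inl ∘ Sum.inr) (u (Sum.inr ())) := by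
        funext j
        simp only [Function.comp_apply, Definitions.snocIdx, Sum.elim_inr]
        refine Fin.lastCases ?_ (fun i => ?_) j
        · simp
        · simp
      rw [e₁, e₂]
    refine (exists_unit h').congr fun K u => ?_
    simp only [Sum.elim_inr, BoundedFormula.realize_ex]
    rfl

end Generic

/-! ### The hypotheses for `L_e` and `L_{exp↾}` -/

/-- Graphs of the ordered-ring symbols. [folklore] -/
theorem funGraph_orderedRing {l : ℕ} (f : Language.orderedRing.Functions l) :
    IsEPolyDefinable (fun (K : Language.Theory.ModelType.{0, 0, w} realExpTheory)
      (u : Fin l ⊕ Unit → K) =>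
        u (Sum.inr ()) = funMap (L := Language.orderedRing) f (u ∘ Sum.inl)) :=
  ringFun_var f Sum.inl (Sum.inr ())

/-- `≤` and its negation. [folklore] -/
theorem relDef_orderedRing {l : ℕ} (R : Language.orderedRing.Relations l) :
    IsEPolyDefinable (fun (K : Language.Theory.ModelType.{0, 0, w} realExpTheory)
        (u : Fin l → K) => RelMap (L := Language.orderedRing) R u) ∧
      IsEPolyDefinable (fun (K : Language.Theory.ModelType.{0, 0, w} realExpTheory)
        (u : Fin l → K) => ¬ RelMap (L := Language.orderedRing) R u) := by
  cases R
  exact ⟨(le_var 0 1).congr fun K u => Iff.rfl, (not_le_var 0 1).congr fun K u => Iff.rfl⟩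

/-- Graphs of the symbols of `L_e`. [cite: DenBesten2016, Theorem 7.2.1 (48)] -/
theorem funGraph_orderedERing {l : ℕ} (g : Language.orderedERing.Functions l) :
    IsEPolyDefinable (fun (K : Language.Theory.ModelType.{0, 0, w} realExpTheory)
      (u : Fin l ⊕ Unit → K) => u (Sum.inr ()) = funMap g (u ∘ Sum.inl)) := by
  rcases g with g | g
  · exact (funGraph_orderedRing g).congr fun K u => by rw [funMap_sumInl]
  · cases g
    exact (e_var (Sum.inl 0) (Sum.inr ())).congr fun K u => Iff.rfl

/-- Relations of `L_e`. [folklore] -/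
theorem relDef_orderedERing {l : ℕ} (R : Language.orderedERing.Relations l) :
    IsEPolyDefinable (fun (K : Language.Theory.ModelType.{0, 0, w} realExpTheory)
        (u : Fin l → K) => RelMap R u) ∧
      IsEPolyDefinable (fun (K : Language.Theory.ModelType.{0, 0, w} realExpTheory)
        (u : Fin l → K) => ¬ RelMap R u) := by
  rcases R with R | R
  · exact ⟨(relDef_orderedRing R).1.congr fun K u => by rw [relMap_sumInl],
      (relDef_orderedRing R).2.congr fun K u => by rw [relMap_sumInl]⟩
  · exact R.elim

/-- Graphs of the symbols of `L_{exp↾}`. [cite: DenBesten2016, Lemma 6.2.3] -/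
theorem funGraph_orderedRexpRing {l : ℕ} (g : Language.orderedRexpRing.Functions l) :
    IsEPolyDefinable (fun (K : Language.Theory.ModelType.{0, 0, w} realExpTheory)
      (u : Fin l ⊕ Unit → K) => u (Sum.inr ()) = funMap g (u ∘ Sum.inl)) := by
  rcases g with g | g
  · exact (funGraph_orderedRing g).congr fun K u => by rw [funMap_sumInl]
  · cases g
    exact (rexp_var (Sum.inl 0) (Sum.inr ())).congr fun K u => Iff.rfl

/-- Relations of `L_{exp↾}`. [folklore] -/
theorem relDef_orderedRexpRing {l : ℕ} (R : Language.orderedRexpRing.Relations l) :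
    IsEPolyDefinable (fun (K : Language.Theory.ModelType.{0, 0, w} realExpTheory)
        (u : Fin l → K) => RelMap R u) ∧
      IsEPolyDefinable (fun (K : Language.Theory.ModelType.{0, 0, w} realExpTheory)
        (u : Fin l → K) => ¬ RelMap R u) := by
  rcases R with R | R
  · exact ⟨(relDef_orderedRing R).1.congr fun K u => by rw [relMap_sumInl],
      (relDef_orderedRing R).2.congr fun K u => by rw [relMap_sumInl]⟩
  · exact R.elim

/-- **Existential `L_e`-formulas are `e`-polynomially definable** (den Besten 2016, Lemma 2.1.5 in
`L_e`). [cite: DenBesten2016, Lemma 2.1.5] -/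
theorem of_isExistential_orderedERing {γ : Type} {n : ℕ}
    {φ : Language.orderedERing.BoundedFormula γ n} (hφ : φ.IsExistential) :
    IsEPolyDefinable (fun (K : Language.Theory.ModelType.{0, 0, w} realExpTheory)
        (u : γ ⊕ Fin n → K) => φ.Realize (u ∘ Sum.inl) (u ∘ Sum.inr)) :=
  of_isExistential_of_graphs funGraph_orderedERing relDef_orderedERing hφ

/-- **Existential `L_{exp↾}`-formulas are `e`-polynomially definable** (den Besten 2016,
Lemma 2.1.5 with Lemma 6.2.3). [cite: DenBesten2016, Lemma 6.2.3] -/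
theorem of_isExistential_orderedRexpRing {γ : Type} {n : ℕ}
    {φ : Language.orderedRexpRing.BoundedFormula γ n} (hφ : φ.IsExistential) :
    IsEPolyDefinable (fun (K : Language.Theory.ModelType.{0, 0, w} realExpTheory)
        (u : γ ⊕ Fin n → K) => φ.Realize (u ∘ Sum.inl) (u ∘ Sum.inr)) :=
  of_isExistential_of_graphs funGraph_orderedRexpRing relDef_orderedRexpRing hφ

end IsEPolyDefinable

/-! ### (48): every `L_e`-formula is a projection of an `e`-polynomial equation -/

/-- **den Besten's normal form (48) from the model completeness of `T_e`**: for every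
`L_e`-formula `φ(x̄)` there are `m` and a polynomial `ρ` with integer coefficients such that in every model `K`
of `T_exp`, `K | L_e ⊨ φ(x̄) ↔ ∃ ȳ ∈ Kᵐ, ρ((x̄, ȳ), e(x̄, ȳ)) = 0`.
[cite: DenBesten2016, Theorem 7.2.1 (48)] -/
theorem exists_ePoly_iff_of_isModelComplete (hMC : eTheory.IsModelComplete) {n : ℕ}
    (φ : Language.orderedERing.Formula (Fin n)) :
    ∃ (m : ℕ) (ρ : Language.orderedRing.Term ((Fin n ⊕ Fin m) ⊕ (Fin n ⊕ Fin m))),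
      ∀ (K : Language.Theory.ModelType.{0, 0, 0} realExpTheory) (x : Fin n → K),
        φ.Realize x ↔ ∃ y : Fin m → K, ρ.realize (ePt (Sum.elim x y)) = 0 := by
  obtain ⟨ψ, hψ, hiff⟩ := hMC.exists_isExistential_iff n φ
  obtain ⟨m, ρ, hρ⟩ := IsEPolyDefinable.of_isExistential_orderedERing.{0} hψ
  let r : (Fin n ⊕ Fin 0) ⊕ Fin m → Fin n ⊕ Fin m := Sum.elim (Sum.elim Sum.inl Fin.elim0) Sum.inr
  refine ⟨m, ρ.relabel (Sum.map r r), fun K x => ?_⟩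
  have h1 : φ.Realize x ↔ ψ.Realize x := hiff.realize_iff
  have h2 := hρ K (Sum.elim x Fin.elim0)
  simp only [Sum.elim_comp_inl, Sum.elim_comp_inr] at h2
  have key : ∀ y : Fin m → K, Sum.elim x y ∘ r = Sum.elim (Sum.elim x Fin.elim0) y := by
    intro y; funext z; rcases z with (z | z) | z
    · rfl
    · exact z.elim0
    · rfl
  rw [h1]
  refine Iff.trans ?_ (h2.trans (exists_congr fun y => ?_))
  · exact iff_of_eq (congrArg (fun xs => BoundedFormula.Realize ψ x xs) (Subsingleton.elim _ _))
  · rw [Term.realize_relabel, ePt_comp_map, key]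

/-- **(48) from Wilkie's First Main Theorem for `exp↾[0,1]`** (`rexpTheory.IsModelComplete`): the
`L_e`-formula is translated into `L_{exp↾}` (`e` is `L_{exp↾}`-definable,
`EOverRestrictedExp.lean`), made existential there, and `exp↾` is `e`-polynomially definable
(`IsEPolyDefinable.rexp_var`). [cite: DenBesten2016, Theorem 7.2.1 (48)] -/
theorem exists_ePoly_iff_of_rexp_isModelComplete (hMC : rexpTheory.IsModelComplete) {n : ℕ}
    (φ : Language.orderedERing.Formula (Fin n)) :
    ∃ (m : ℕ) (ρ : Language.orderedRing.Term ((Fin n ⊕ Fin m) ⊕ (Fin n ⊕ Fin m))),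
      ∀ (K : Language.Theory.ModelType.{0, 0, 0} realExpTheory) (x : Fin n → K),
        φ.Realize x ↔ ∃ y : Fin m → K, ρ.realize (ePt (Sum.elim x y)) = 0 := by
  -- translate `φ` into `L_{exp↾}`
  let φ' : Language.orderedRexpRing.Formula (Fin n) :=
    Definitions.translateFormula eOverRexpDefs (orderedERingRexpHom.onFormula φ)
  have hφ' : ∀ (K : Language.Theory.ModelType.{0, 0, 0} realExpTheory) (x : Fin n → K),
      φ'.Realize x ↔ φ.Realize x := fun K x =>
    (Definitions.realize_translateFormula (eOverRexpDefs_isDefinedBy K) _ x).trans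
      (LHom.realize_onFormula orderedERingRexpHom φ)
  obtain ⟨ψ, hψ, hiff⟩ := hMC.exists_isExistential_iff n φ'
  obtain ⟨m, ρ, hρ⟩ := IsEPolyDefinable.of_isExistential_orderedRexpRing.{0} hψ
  let r : (Fin n ⊕ Fin 0) ⊕ Fin m → Fin n ⊕ Fin m := Sum.elim (Sum.elim Sum.inl Fin.elim0) Sum.inr
  refine ⟨m, ρ.relabel (Sum.map r r), fun K x => ?_⟩
  have h1 : φ'.Realize x ↔ ψ.Realize x := hiff.realize_iff
  have h2 := hρ K (Sum.elim x Fin.elim0)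
  simp only [Sum.elim_comp_inl, Sum.elim_comp_inr] at h2
  have key : ∀ y : Fin m → K, Sum.elim x y ∘ r = Sum.elim (Sum.elim x Fin.elim0) y := by
    intro y; funext z; rcases z with (z | z) | z
    · rfl
    · exact z.elim0
    · rfl
  rw [← hφ' K x, h1]
  refine Iff.trans ?_ (h2.trans (exists_congr fun y => ?_))
  · exact iff_of_eq (congrArg (fun xs => BoundedFormula.Realize ψ x xs) (Subsingleton.elim _ _))
  · rw [Term.realize_relabel, ePt_comp_map, key]

end RealExpModel

end Literature.ModelTheory.ExponentialFields
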